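import Summits.QuantumFields.BalabanUV.T4Continuum.Support.NE3EnergyHessCont

/-!
# T⁴ programme, node NE3, route P2 «ENERGY CONVEXITY» — sub-row S5-Y8a part 1c, file 1∕2: THE TWO-TERM BOUND ON THE
# WILSON HESSIAN AT ONE CONFIGURATION (curl term kept, dressing carried by the plaquette radius)

NE3 formalisation swarm `b2b-balaban-t4-ne3-formalise-*` of the cell `pub-balaban`, unit
`b2b-balaban-t4-ne3-formalise-leaf-03` (gen 4), sub-row **S5-Y8a-1c** of `t4/formal/NE3/LEAVES.md` (journal INTENT
2026-08-20T10:38Z; parts 1∕1b of the family: `NE3EnergyHessBilin` p214531 ∕ `NE3EnergyHessCont` p214575).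

WHY.  `NE3EnergyHessCont.cont_field` bounds the symmetrised Hessian by `48·d·√dirSq Y·√dirSq Z` — bond squares ONLY.
That is k-uniform in the tree's unweighted `energyNorm` but gives `48·d·L^{2k}` in any DOWN-weighted currency
`√(curlSq + dirSq∕L^{2k})` (cross-read FINDING-INFO-1 on p214531∕p214575, journal 2026-08-20T10:27Z; currency objection
G-ne7king10-1).  The cure is to keep the CURL term as the main part and let the `dirSq` part carry the plaquette radius
`a` of the configuration.  THIS FILE is that one-configuration bound; its §§ are ADAPTED, WITH CREDIT, from the
cross-reader's kernel probe `HOME/b2b-balaban-t4-ne7-ideate-king1986/xread/Probe_p214531_p214575.lean` §D (king1986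
gen 13, «adoptable», journal l.11096) — [folklore] matrix inequalities, 0 `def`, 0 sorry:
* `nReTr_dcurlAt` — `Re tr (dcurlAt V X Y ·) = 0` for ALL `X, Y` (the tree's `NE3HessBounds.nReTr_dcurlAt_self` is the
  diagonal);
* **`abs_hessPlaqAt_le_twoTerm`** — `|hessPlaqAt V X Y p′| ≤ ‖d_V X(p′)‖·‖d_V Y(p′)‖ + 3a·bondL1At X·bondL1At Y` under
  `‖V(∂p′) − 1‖ ≤ a` (compare `NE3HessContinuity.abs_hessPlaqAt_le`: everything by `3·bondL1At·bondL1At`);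
* `abs_hess_le_twoTerm` (window; Cauchy–Schwarz twice) and **`abs_hessSym_perWin_le_twoTerm`** —
  `|hessSym V (perWin d M) Y Z| ≤ √curlSq(V,Y)·√curlSq(V,Z) + 48·d·a·√dirSq Y·√dirSq Z` for `M`-periodic `Y, Z`.
File 2∕2 (`Support/NE3EnergyHessContTwoTerm`) transports the curl term to the FIXED background of `RouteLeaves`.

HONEST FRAMING.  Finite-T⁴ bookkeeping (rung (B)+1); matrix inequalities over the tree's explicit finite sums; NOTHING
about Bałaban's minimisers; no `TangentCoercive` ∕ `coer` ∕ `hP` stated or consumed and NO norm chosen (LEAVES ρ19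
clean); no conditional of the cell (`BetaPertH`, (B), G-an2-4) used or hidden; NOT infinite volume ∕ mass gap ∕ Clay ∕
summit progress; **NE3 is NOT proved**; spine PROVED 0∕9.  ABSOLUTE RULE kept (no printed sentence is a hypothesis;
context [Balaban1985BackgroundPropagators] (3.10) p. 392, [Balaban1985Variational] (26)–(27) p. 282).  PLACEMENT:
`Summits/QuantumFields/BalabanUV/`; imports `Support.NE3EnergyHessCont` BY NAME; restates nothing, moves nothing.
-/


set_option autoImplicit false

open scoped BigOperators Matrix.Norms.L2Operator
open NormedSpace Finset

namespace Summit.QuantumFields.BalabanUV.T4Continuum.NE3EnergyHessTwoTerm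

open Literature.MathematicalPhysics.QuantumFieldTheory.Balaban1983to89
open B7Prop1Explicit B7Prop2Explicit MatrixLog UnitaryModel
open T4AveragingDeficitWall hiding Site Plane Plaq Bond
open T4AveragingDeficitWallBoundary (periodBox)
open AveragingDeficitPeriodicCounting (IsPeriodicDir)
open AveragingDeficitNearIdentity (abs_nReTr_mul_le)
open MinimalActionLevels (perWin)
open NE3HessForm (dcurlAt hessPlaqAt hess)
open NE3HessBounds (bondSq bondSqAt nReTr_Ad_comm norm_curlAt_le)
open NE3HessContinuity (bondL1At bondL1 bondL1At_nonneg bondL1At_sq_le norm_dcurlAt_le)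
open NE3HessShapes (plaqsOf curlSq_eq_sum_plaqsOf sum_plaqsOf_bondSq_le)
open NE3EnergyHessBilin (hessSym hessSym_apply)
open NE3EnergyHessCont (HsPer HsPer_apply_of_periodic perWin_eq_plaqsOf)

noncomputable section

variable {d : ℕ} {n : Type*} [Fintype n] [DecidableEq n]

/-! ## §1 The two-term bound at one configuration (adapted from king1986 g13's probe §D, with credit) -/

/-- `Re tr (dcurlAt V X Y p′) = 0` for ALL `X, Y`: every term of `NE3HessForm.dcurlAt` is a transported commutator (the
tree's `NE3HessBounds.nReTr_dcurlAt_self` is the case `Y = X`; same proof).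
-- adapted from HOME/b2b-balaban-t4-ne7-ideate-king1986/xread/Probe_p214531_p214575.lean §D (iii-a), king1986 g13. [folklore] -/
theorem nReTr_dcurlAt (V : Site d → Fin d → (Matrix n n ℂ)ˣ) (X Y : Site d → Fin d → Matrix n n ℂ) (z : Site d)
    (μ ν : Fin d) : nReTr (dcurlAt V X Y z μ ν) = 0 := by
  simp only [dcurlAt, T4TiltOscillation.nReTr_add, T4TiltOscillation.nReTr_sub, nReTr_Ad_comm]
  ring

/-- **THE TWO-TERM BOUND AT ONE PLAQUETTE**: for unitary `V` and a plaquette with `‖V(∂p′) − 1‖ ≤ a`,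
`|hessPlaqAt V X Y p′| ≤ ‖(d_V X)(p′)‖·‖(d_V Y)(p′)‖ + 3a·bondL1At X p′·bondL1At Y p′` — main term in the dressed curls
(the flat part `−Re tr[(d_V Y)(d_V X)]`, by `nReTr_dcurlAt`), dressing with the plaquette radius (compare
`NE3HessContinuity.abs_hessPlaqAt_le`: everything by `3·bondL1At X·bondL1At Y`).
-- adapted from king1986 g13's probe §D (iii-b). [folklore] -/
theorem abs_hessPlaqAt_le_twoTerm [Nonempty n] {V : Site d → Fin d → (Matrix n n ℂ)ˣ} (hV : IsUnitaryCfg V)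
    (X Y : Site d → Fin d → Matrix n n ℂ) (z : Site d) (μ ν : Fin d) {a : ℝ}
    (hp : ‖((hol V z (plaqWord μ ν) : (Matrix n n ℂ)ˣ) : Matrix n n ℂ) - 1‖ ≤ a) :
    |hessPlaqAt V X Y z μ ν|
      ≤ ‖curlAt V X z μ ν‖ * ‖curlAt V Y z μ ν‖ + 3 * a * (bondL1At X z μ ν * bondL1At Y z μ ν) := by
  have hD : nReTr (dcurlAt V X Y z μ ν) = 0 := nReTr_dcurlAt V X Y z μ ν
  set D := dcurlAt V X Y z μ ν
  set CX := curlAt V X z μ ν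
  set CY := curlAt V Y z μ ν
  set H := ((hol V z (plaqWord μ ν) : (Matrix n n ℂ)ˣ) : Matrix n n ℂ)
  have h0 : hessPlaqAt V X Y z μ ν = -nReTr ((D + CY * CX) * H) := rfl
  have hsplit : (D + CY * CX) * H = (D + CY * CX) * (H - 1) + (D + CY * CX) := by noncomm_ring
  have h1 : nReTr ((D + CY * CX) * H) = nReTr ((D + CY * CX) * (H - 1)) + nReTr (CY * CX) := by
    rw [hsplit, T4TiltOscillation.nReTr_add, T4TiltOscillation.nReTr_add, hD, zero_add]
  have hB : 0 ≤ bondL1At X z μ ν * bondL1At Y z μ ν :=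
    mul_nonneg (bondL1At_nonneg _ _ _ _) (bondL1At_nonneg _ _ _ _)
  have h3 : ‖D + CY * CX‖ ≤ 3 * (bondL1At X z μ ν * bondL1At Y z μ ν) := by
    have hd : ‖D‖ ≤ 2 * (bondL1At X z μ ν * bondL1At Y z μ ν) := norm_dcurlAt_le hV X Y z μ ν
    have hc : ‖CY * CX‖ ≤ bondL1At Y z μ ν * bondL1At X z μ ν :=
      calc ‖CY * CX‖ ≤ ‖CY‖ * ‖CX‖ := norm_mul_le _ _
        _ ≤ bondL1At Y z μ ν * bondL1At X z μ ν :=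
            mul_le_mul (norm_curlAt_le hV Y z μ ν) (norm_curlAt_le hV X z μ ν) (norm_nonneg _)
              (bondL1At_nonneg Y z μ ν)
    calc ‖D + CY * CX‖ ≤ ‖D‖ + ‖CY * CX‖ := norm_add_le _ _
      _ ≤ 2 * (bondL1At X z μ ν * bondL1At Y z μ ν) + bondL1At Y z μ ν * bondL1At X z μ ν := add_le_add hd hc
      _ = 3 * (bondL1At X z μ ν * bondL1At Y z μ ν) := by ring
  have h4 : |nReTr ((D + CY * CX) * (H - 1))| ≤ 3 * a * (bondL1At X z μ ν * bondL1At Y z μ ν) := by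
    refine (abs_nReTr_mul_le _ _).trans ?_
    calc ‖D + CY * CX‖ * ‖H - 1‖ ≤ (3 * (bondL1At X z μ ν * bondL1At Y z μ ν)) * a :=
          mul_le_mul h3 hp (norm_nonneg _) (mul_nonneg (by norm_num) hB)
      _ = 3 * a * (bondL1At X z μ ν * bondL1At Y z μ ν) := by ring
  have h5 : |nReTr (CY * CX)| ≤ ‖CX‖ * ‖CY‖ := by
    rw [mul_comm ‖CX‖]; exact abs_nReTr_mul_le _ _
  rw [h0, h1, abs_neg]
  calc |nReTr ((D + CY * CX) * (H - 1)) + nReTr (CY * CX)|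
      ≤ |nReTr ((D + CY * CX) * (H - 1))| + |nReTr (CY * CX)| := abs_add_le _ _
    _ ≤ 3 * a * (bondL1At X z μ ν * bondL1At Y z μ ν) + ‖CX‖ * ‖CY‖ := add_le_add h4 h5
    _ = ‖CX‖ * ‖CY‖ + 3 * a * (bondL1At X z μ ν * bondL1At Y z μ ν) := add_comm _ _

/-- **THE TWO-TERM BOUND ON A WINDOW** (Cauchy–Schwarz twice): for unitary `V` with plaquette radius `a ≥ 0` on `W`,
`|hess V X Y W| ≤ √(Σ_{p∈W}‖d_V X(p)‖²)·√(Σ_{p∈W}‖d_V Y(p)‖²) + 12a·√(Σ bondSq X)·√(Σ bondSq Y)`.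
-- adapted from king1986 g13's probe §D (iii-c). [folklore] -/
theorem abs_hess_le_twoTerm [Nonempty n] {V : Site d → Fin d → (Matrix n n ℂ)ˣ} (hV : IsUnitaryCfg V)
    (X Y : Site d → Fin d → Matrix n n ℂ) (W : Finset (T4AveragingDeficitWall.Plaq d)) {a : ℝ} (ha0 : 0 ≤ a)
    (ha : ∀ p ∈ W, ‖((fhol V p : (Matrix n n ℂ)ˣ) : Matrix n n ℂ) - 1‖ ≤ a) :
    |hess V X Y W| ≤ Real.sqrt (∑ p ∈ W, ‖curl V X p‖ ^ 2) * Real.sqrt (∑ p ∈ W, ‖curl V Y p‖ ^ 2)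
        + 12 * a * (Real.sqrt (∑ p ∈ W, bondSq X p) * Real.sqrt (∑ p ∈ W, bondSq Y p)) := by
  have h1 : |hess V X Y W| ≤ ∑ p ∈ W, (‖curl V X p‖ * ‖curl V Y p‖ + 3 * a * (bondL1 X p * bondL1 Y p)) := by
    unfold hess
    refine (Finset.abs_sum_le_sum_abs _ _).trans (Finset.sum_le_sum fun p hp => ?_)
    exact abs_hessPlaqAt_le_twoTerm hV X Y p.1 p.2.1.1 p.2.1.2 (ha p hp)
  -- main term: Cauchy–Schwarz
  have hM0 : 0 ≤ ∑ p ∈ W, ‖curl V X p‖ * ‖curl V Y p‖ :=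
    Finset.sum_nonneg fun p _ => mul_nonneg (norm_nonneg _) (norm_nonneg _)
  have hMX : 0 ≤ ∑ p ∈ W, ‖curl V X p‖ ^ 2 := Finset.sum_nonneg fun p _ => sq_nonneg _
  have hcsM : (∑ p ∈ W, ‖curl V X p‖ * ‖curl V Y p‖) ^ 2
      ≤ (∑ p ∈ W, ‖curl V X p‖ ^ 2) * (∑ p ∈ W, ‖curl V Y p‖ ^ 2) :=
    Finset.sum_mul_sq_le_sq_mul_sq W (fun p => ‖curl V X p‖) (fun p => ‖curl V Y p‖)
  have hM : ∑ p ∈ W, ‖curl V X p‖ * ‖curl V Y p‖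
      ≤ Real.sqrt (∑ p ∈ W, ‖curl V X p‖ ^ 2) * Real.sqrt (∑ p ∈ W, ‖curl V Y p‖ ^ 2) := by
    rw [← Real.sqrt_mul hMX, ← Real.sqrt_sq hM0]
    exact Real.sqrt_le_sqrt hcsM
  -- dressing term: as in `NE3HessContinuity.abs_hess_le`
  have hcs : (∑ p ∈ W, bondL1 X p * bondL1 Y p) ^ 2 ≤ (∑ p ∈ W, bondL1 X p ^ 2) * (∑ p ∈ W, bondL1 Y p ^ 2) :=
    Finset.sum_mul_sq_le_sq_mul_sq W (fun p => bondL1 X p) (fun p => bondL1 Y p)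
  have hX : ∑ p ∈ W, bondL1 X p ^ 2 ≤ 4 * ∑ p ∈ W, bondSq X p := by
    rw [Finset.mul_sum]; exact Finset.sum_le_sum fun p _ => bondL1At_sq_le X p.1 p.2.1.1 p.2.1.2
  have hY : ∑ p ∈ W, bondL1 Y p ^ 2 ≤ 4 * ∑ p ∈ W, bondSq Y p := by
    rw [Finset.mul_sum]; exact Finset.sum_le_sum fun p _ => bondL1At_sq_le Y p.1 p.2.1.1 p.2.1.2
  have hPX : 0 ≤ ∑ p ∈ W, bondL1 X p ^ 2 := Finset.sum_nonneg fun p _ => sq_nonneg _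
  have hS0 : 0 ≤ ∑ p ∈ W, bondL1 X p * bondL1 Y p :=
    Finset.sum_nonneg fun p _ => mul_nonneg (bondL1At_nonneg X _ _ _) (bondL1At_nonneg Y _ _ _)
  have hsqrt4 : Real.sqrt 4 = 2 := by
    rw [show (4 : ℝ) = 2 ^ 2 by norm_num, Real.sqrt_sq (by norm_num)]
  have h3a : ∑ p ∈ W, bondL1 X p * bondL1 Y p
      ≤ Real.sqrt (∑ p ∈ W, bondL1 X p ^ 2) * Real.sqrt (∑ p ∈ W, bondL1 Y p ^ 2) := by
    rw [← Real.sqrt_mul hPX, ← Real.sqrt_sq hS0]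
    exact Real.sqrt_le_sqrt hcs
  have h3b : Real.sqrt (∑ p ∈ W, bondL1 X p ^ 2) ≤ 2 * Real.sqrt (∑ p ∈ W, bondSq X p) := by
    rw [← hsqrt4, ← Real.sqrt_mul (by norm_num : (0:ℝ) ≤ 4)]
    exact Real.sqrt_le_sqrt hX
  have h3c : Real.sqrt (∑ p ∈ W, bondL1 Y p ^ 2) ≤ 2 * Real.sqrt (∑ p ∈ W, bondSq Y p) := by
    rw [← hsqrt4, ← Real.sqrt_mul (by norm_num : (0:ℝ) ≤ 4)]
    exact Real.sqrt_le_sqrt hY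
  have h3 : ∑ p ∈ W, bondL1 X p * bondL1 Y p
      ≤ 4 * (Real.sqrt (∑ p ∈ W, bondSq X p) * Real.sqrt (∑ p ∈ W, bondSq Y p)) := by
    have hm := mul_le_mul h3b h3c (Real.sqrt_nonneg _) (by positivity)
    linarith
  have hsum : ∑ p ∈ W, (‖curl V X p‖ * ‖curl V Y p‖ + 3 * a * (bondL1 X p * bondL1 Y p))
      = (∑ p ∈ W, ‖curl V X p‖ * ‖curl V Y p‖) + 3 * a * ∑ p ∈ W, bondL1 X p * bondL1 Y p := by
    rw [Finset.sum_add_distrib, Finset.mul_sum]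
  have h3' : 3 * a * ∑ p ∈ W, bondL1 X p * bondL1 Y p
      ≤ 12 * a * (Real.sqrt (∑ p ∈ W, bondSq X p) * Real.sqrt (∑ p ∈ W, bondSq Y p)) := by
    have := mul_le_mul_of_nonneg_left h3 (by positivity : (0:ℝ) ≤ 3 * a)
    linarith
  linarith [h1, hM, h3', hsum.le, hsum.ge]

/-- **THE TWO-TERM BOUND ON THE TORUS**: for unitary `V` with plaquette radius `a ≥ 0` on the period window, `M ≥ 1` and
`M`-periodic `Y, Z`:  `|hessSym V (perWin d M) Y Z| ≤ √curlSq(V,Y)·√curlSq(V,Z) + 48·d·a·√dirSq Y·√dirSq Z` (sums over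
`periodBox M`; bond multiplicity `NE3HessShapes.sum_plaqsOf_bondSq_le`).
-- adapted from king1986 g13's probe §D (iii-d). [folklore] -/
theorem abs_hessSym_perWin_le_twoTerm [Nonempty n] {V : Site d → Fin d → (Matrix n n ℂ)ˣ} (hV : IsUnitaryCfg V)
    {M : ℕ} (hM : 1 ≤ M) {a : ℝ} (ha0 : 0 ≤ a)
    (ha : ∀ p ∈ perWin d M, ‖((fhol V p : (Matrix n n ℂ)ˣ) : Matrix n n ℂ) - 1‖ ≤ a)
    {Y Z : Site d → Fin d → Matrix n n ℂ} (hY : IsPeriodicDir Y (M : ℤ)) (hZ : IsPeriodicDir Z (M : ℤ)) :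
    |hessSym V (perWin d M) Y Z|
      ≤ Real.sqrt (curlSq V Y (periodBox M)) * Real.sqrt (curlSq V Z (periodBox M))
        + 48 * d * a * (Real.sqrt (dirSq Y (periodBox M)) * Real.sqrt (dirSq Z (periodBox M))) := by
  have h1 := abs_hess_le_twoTerm hV Y Z (perWin d M) ha0 ha
  have h2 := abs_hess_le_twoTerm hV Z Y (perWin d M) ha0 ha
  rw [perWin_eq_plaqsOf] at h1 h2 ⊢
  rw [← curlSq_eq_sum_plaqsOf, ← curlSq_eq_sum_plaqsOf] at h1 h2
  have h4d : (0 : ℝ) ≤ 4 * (d : ℝ) := by positivity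
  have hbY := sum_plaqsOf_bondSq_le (n := n) hM hY
  have hbZ := sum_plaqsOf_bondSq_le (n := n) hM hZ
  set bY := Real.sqrt (∑ p ∈ plaqsOf (periodBox M), bondSq Y p) with hbYd
  set bZ := Real.sqrt (∑ p ∈ plaqsOf (periodBox M), bondSq Z p) with hbZd
  set y := Real.sqrt (dirSq Y (periodBox M)) with hy
  set z := Real.sqrt (dirSq Z (periodBox M)) with hz
  set cY := Real.sqrt (curlSq V Y (periodBox M))
  set cZ := Real.sqrt (curlSq V Z (periodBox M))
  have hbZ0 : 0 ≤ bZ := Real.sqrt_nonneg _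
  have hy0 : 0 ≤ y := Real.sqrt_nonneg _
  have hs0 : 0 ≤ Real.sqrt (4 * (d : ℝ)) := Real.sqrt_nonneg _
  have hY' : bY ≤ Real.sqrt (4 * (d : ℝ)) * y := by
    rw [hbYd, hy, ← Real.sqrt_mul h4d]; exact Real.sqrt_le_sqrt hbY
  have hZ' : bZ ≤ Real.sqrt (4 * (d : ℝ)) * z := by
    rw [hbZd, hz, ← Real.sqrt_mul h4d]; exact Real.sqrt_le_sqrt hbZ
  have hs : Real.sqrt (4 * (d : ℝ)) * Real.sqrt (4 * (d : ℝ)) = 4 * d := Real.mul_self_sqrt h4d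
  have hab' : bY * bZ ≤ 4 * d * (y * z) := by
    calc bY * bZ ≤ (Real.sqrt (4 * (d : ℝ)) * y) * (Real.sqrt (4 * (d : ℝ)) * z) :=
          mul_le_mul hY' hZ' hbZ0 (mul_nonneg hs0 hy0)
      _ = (Real.sqrt (4 * (d : ℝ)) * Real.sqrt (4 * (d : ℝ))) * (y * z) := by ring
      _ = 4 * d * (y * z) := by rw [hs]
  have h12 : 12 * a * (bY * bZ) ≤ 48 * d * a * (y * z) := by
    calc 12 * a * (bY * bZ) ≤ 12 * a * (4 * d * (y * z)) := mul_le_mul_of_nonneg_left hab' (by positivity)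
      _ = 48 * d * a * (y * z) := by ring
  rw [mul_comm bZ bY, mul_comm cZ cY] at h2
  rw [hessSym_apply, abs_div, abs_two, div_le_iff₀ (by norm_num : (0:ℝ) < 2)]
  have hadd := abs_add_le (hess V Y Z (plaqsOf (periodBox M))) (hess V Z Y (plaqsOf (periodBox M)))
  linarith

end

end Summit.QuantumFields.BalabanUV.T4Continuum.NE3EnergyHessTwoTerm
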